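import Literature.NumberTheory.LFunctions.WeilExplicit
import Literature.NumberTheory.LFunctions.WeilExplicitProofs
import Literature.NumberTheory.LFunctions.WeilMellinBounds
import Literature.NumberTheory.LFunctions.WeilZeroSum
import Literature.NumberTheory.LFunctions.GeneralizedRH
import Literature.NumberTheory.LFunctions.ZetaRealAxis
import Literature.Analysis.Complex.BoundedPowerSums
import HarnessLib

/-!
# The converse half of Weil's criterion in zero-side form (Bombieri 2000, Theorem 1, "if" half)

Proof file (D-0014, theorems and auxiliary definitions only — no named facts) for the converse
("if") half of E. Bombieri, *Remarks on Weil's quadratic functional in the theory of prime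
numbers I*, Rend. Mat. Acc. Lincei (9) 11 (2000), 183–233, §3, **Theorem 1** ("The Riemann
Hypothesis holds if and only if `∑_ρ g̃(ρ) \overline{g̃}(1 - ρ) > 0` for every complex-valued
`g(x) ∈ C₀^∞((0, ∞))`, not identically `0`"; originally A. Weil 1952), in the semidefinite
ZERO-SIDE form recorded by the tree's named fact `Literature.NumberTheory.LFunctions.weil_criterion_zeroSide_converse`
(`Literature/NumberTheory/LFunctions/WeilCriterionProofs.lean`):

  if for every smooth compactly supported `g : ℝ → ℂ` every limit `Z` of the symmetric partial
  sums of `m(ρ) (g ⋆ g̃)^(ρ)` over the non-trivial zeros (`HasWeilZeroSide (g ⋆ g̃) Z`, objects of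
  `WeilExplicit.lean`) has `Re Z ≥ 0`, then `RiemannHypothesis`

— the main theorem `WeilConverse.riemannHypothesis_of_zeroSide_nonneg` below, stated with the
hypothesis unfolded so that this file does not depend on `WeilCriterionProofs.lean` (which imports
it and turns it into `weil_criterion_zeroSide_converse_holds` and, with the explicit formula,
`weil_criterion_holds`). No prime side enters.

## The proof

The printed proof (Bombieri 2000, pp. 189–190) goes through Li's criterion [Bombieri–Lagarias]
and the de la Vallée-Poussin zero-free region. The proof below is a different, self-contained
route to the same printed statement (semidefinite form): a Laplace-transform/identity-theorem
argument that needs neither a zero-free region nor Bochner's theorem.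

* For a test function `g` put `P_g(ρ) = ĝ(ρ) conj ĝ(1 - ρ̄)` (`= (g ⋆ g̃)^(ρ)`,
  `weilMellin_weilQuadratic`) and `Q(g) = ∑_ρ m(ρ) P_g(ρ)` over the non-trivial zeros; the series
  converges absolutely (`|ĝ| ≪ (1+γ²)^{-1}` in the strip, `norm_weilMellin_le`, and
  `∑ m(ρ)/(1+γ²)² < ∞`, `weilZeroSummable`), so it IS the symmetric limit
  (`hasWeilZeroSide_tsum`) and the hypothesis gives `Re Q(g) ≥ 0`.
* Translation `g_x(t) = g(t - x)` multiplies `ĝ(s)` by `e^{(s-1/2)x}`; expanding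
  `Q(g + c g_x) ≥ 0` (`|c| = 1`) and using the reflection `ρ ↦ 1 - ρ̄` of the zero set (which
  preserves multiplicities, `riemannZetaZeroOrder_one_sub_conj`) shows that the generalised
  Dirichlet series `B(x) = ∑_ρ m(ρ) P_g(ρ) e^{(ρ - 1/2)x}` satisfies `|B(x)| ≤ Re Q(g)` for all
  real `x`.
* A bounded absolutely convergent exponential sum with locally finite exponents has no terms
  off the imaginary axis (`BoundedPowerSum.sum_fiber_eq_zero_of_exp_real`, Laplace transform +
  identity theorem): `m(ρ) P_g(ρ) = 0` whenever `Re ρ ≠ 1/2`.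
* A narrow bump `g` has `Re ĝ > 0` on the whole horizontal line through `ρ` and `1 - ρ̄`
  (`exists_isWeilTest_re_weilMellin_pos`), so `P_g(ρ) ≠ 0`, and `m(ρ) ≥ 1`: every zero with
  `Im ρ ≠ 0` has `Re ρ = 1/2`. Real zeros in `(0, 1)` do not exist
  (`Literature.NumberTheory.LFunctions.riemannZeta_ofReal_ne_zero_of_pos_of_lt_one`), and zeros outside the open strip are
  trivial (`riemannHypothesis_iff_strip_holds`), whence Mathlib's `RiemannHypothesis`.

## Contents (`namespace Literature.WeilConverse`)

* `pairCoeff`, `zeroForm`, `expSum`, `expSum'` — `P_g`, `Q(g)`, `B_g`, `A_g`; summability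
  (`summable_pairCoeff`, `summable_expSum`, `summable_expSum'`), `hasWeilZeroSide_zeroForm`,
  `zeroForm_re_nonneg`.
* `translateMix g c x = g + c · g(· - x)`, `isWeilTest_translateMix`, `pairCoeff_translateMix`,
  `zeroForm_translateMix` (the polarisation/translation expansion).
* `reflect`, `reflectEquiv` (`ρ ↦ 1 - ρ̄` on the non-trivial zeros), `conj_expSum'`,
  `norm_expSum_le`
  (`|B_g(x)| ≤ Re Q(g)`), `order_mul_pairCoeff_eq_zero` (no terms off the line), `re_eq_one_half`.
* `riemannHypothesis_of_zeroSide_nonneg` — the converse half (MAIN THEOREM).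

## References

* E. Bombieri, *Remarks on Weil's quadratic functional in the theory of prime numbers I*, Atti
  Accad. Naz. Lincei Cl. Sci. Fis. Mat. Natur. Rend. Lincei (9) Mat. Appl. 11 (2000), no. 3,
  183–233, §3 Thm. 1 (Zbl 1008.11034).
* A. Weil, *Sur les "formules explicites" de la théorie des nombres premiers*, Comm. Sém. Math.
  Univ. Lund, Tome suppl. (1952), 252–265.
* E. Bombieri, J. C. Lagarias, *Complements to Li's criterion for the Riemann Hypothesis*,
  J. Number Theory 77 (1999), 274–287.
-/

noncomputable section

open Complex Filter Set MeasureTheory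
open scoped Real Topology ComplexConjugate

namespace Literature.NumberTheory.LFunctions

namespace WeilConverse

/-! ### The zero-side pairing of a test function -/

/-- `P_g(ρ) = ĝ(ρ) · conj ĝ(1 - ρ̄)`, the value at `ρ` of the transform of `g ⋆ g̃`
(`weilMellin_weilQuadratic`; Bombieri 2000 §3). [cite: Bombieri2000Weil, §3] -/
def pairCoeff (g : ℝ → ℂ) (ρ : ℂ) : ℂ :=
  weilMellin g ρ * conj (weilMellin g (1 - conj ρ))

/-- `Q(g) = ∑_ρ m(ρ) P_g(ρ)` over the non-trivial zeros (a `tsum`, junk value `0` if the series is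
not summable; for test `g` it converges absolutely, `summable_pairCoeff`, and is the zero side of
`g ⋆ g̃`, `hasWeilZeroSide_zeroForm`). [cite: Bombieri2000Weil, Thm. 1] -/
def zeroForm (g : ℝ → ℂ) : ℂ :=
  ∑' ρ : ZetaZeros.riemannZetaNontrivialZeros, (riemannZetaZeroOrder (ρ : ℂ) : ℂ) * pairCoeff g ρ

/-- The generalised Dirichlet series `B_g(x) = ∑_ρ m(ρ) P_g(ρ) e^{(ρ - 1/2) x}` (a `tsum`, junk
value `0` if not summable; absolutely convergent for test `g`, `summable_expSum`). [folklore] -/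
def expSum (g : ℝ → ℂ) (x : ℝ) : ℂ :=
  ∑' ρ : ZetaZeros.riemannZetaNontrivialZeros,
    (riemannZetaZeroOrder (ρ : ℂ) : ℂ) * pairCoeff g ρ * cexp (((ρ : ℂ) - 1 / 2) * x)

/-- The reflected series `A_g(x) = ∑_ρ m(ρ) P_g(ρ) e^{(1/2 - ρ) x}` (a `tsum`; absolutely
convergent for test `g`, `summable_expSum'`; `conj A_g = B_g`, `conj_expSum'`). [folklore] -/
def expSum' (g : ℝ → ℂ) (x : ℝ) : ℂ :=
  ∑' ρ : ZetaZeros.riemannZetaNontrivialZeros,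
    (riemannZetaZeroOrder (ρ : ℂ) : ℂ) * pairCoeff g ρ * cexp ((1 / 2 - (ρ : ℂ)) * x)

/-- `Re (1 - ρ̄) = 1 - Re ρ`. [folklore] -/
theorem one_sub_conj_re (ρ : ℂ) : (1 - conj ρ).re = 1 - ρ.re := by simp

/-- `Im (1 - ρ̄) = Im ρ`: the reflection fixes ordinates. [folklore] -/
theorem one_sub_conj_im (ρ : ℂ) : (1 - conj ρ).im = ρ.im := by simp

/-- `|P_g(ρ)| ≤ C_g² / (1 + γ²)²` on the non-trivial zeros (`norm_weilMellin_le` at `ρ` and at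
`1 - ρ̄`, which have the same ordinate and real parts in `[0, 1]`). [folklore] -/
theorem norm_pairCoeff_le {g : ℝ → ℂ} (hg : IsWeilTest g) {ρ : ℂ}
    (hρ : ρ ∈ ZetaZeros.riemannZetaNontrivialZeros) :
    ‖pairCoeff g ρ‖ ≤ weilDecayConst g ^ 2 / (1 + ρ.im ^ 2) ^ 2 := by
  have h1 : ‖weilMellin g ρ‖ ≤ weilDecayConst g / (1 + ρ.im ^ 2) :=
    norm_weilMellin_le hg (ZetaZeros.riemannZetaNontrivialZeros.re_pos hρ).le
      (ZetaZeros.riemannZetaNontrivialZeros.re_lt_one hρ).le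
  have h2 : ‖weilMellin g (1 - conj ρ)‖ ≤ weilDecayConst g / (1 + ρ.im ^ 2) := by
    have := norm_weilMellin_le hg (s := 1 - conj ρ)
      (by rw [one_sub_conj_re]; linarith [ZetaZeros.riemannZetaNontrivialZeros.re_lt_one hρ])
      (by rw [one_sub_conj_re]; linarith [ZetaZeros.riemannZetaNontrivialZeros.re_pos hρ])
    rwa [one_sub_conj_im] at this
  have h0 : 0 ≤ weilDecayConst g / (1 + ρ.im ^ 2) :=
    div_nonneg (weilDecayConst_nonneg g) (by positivity)
  calc ‖pairCoeff g ρ‖ = ‖weilMellin g ρ‖ * ‖weilMellin g (1 - conj ρ)‖ := by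
        rw [pairCoeff, norm_mul, Complex.norm_conj]
    _ ≤ (weilDecayConst g / (1 + ρ.im ^ 2)) * (weilDecayConst g / (1 + ρ.im ^ 2)) :=
        mul_le_mul h1 h2 (norm_nonneg _) h0
    _ = weilDecayConst g ^ 2 / (1 + ρ.im ^ 2) ^ 2 := by rw [div_mul_div_comm, ← pow_two, ← pow_two]

/-- `|e^{w x}| ≤ e^{|x|/2}` for `|Re w| ≤ 1/2` and real `x`. [folklore] -/
theorem norm_cexp_mul_real_le {w : ℂ} (hw : |w.re| ≤ 1 / 2) (x : ℝ) :
    ‖cexp (w * x)‖ ≤ Real.exp (|x| / 2) := by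
  rw [Complex.norm_exp, Real.exp_le_exp]
  have hre : (w * x).re = w.re * x := by simp [Complex.mul_re]
  rw [hre]
  calc w.re * x ≤ |w.re * x| := le_abs_self _
    _ = |w.re| * |x| := abs_mul _ _
    _ ≤ 1 / 2 * |x| := mul_le_mul_of_nonneg_right hw (abs_nonneg x)
    _ = |x| / 2 := by ring

/-- `|Re ρ - 1/2| ≤ 1/2` on the non-trivial zeros. [folklore] -/
theorem abs_re_sub_half_le {ρ : ℂ} (hρ : ρ ∈ ZetaZeros.riemannZetaNontrivialZeros) :
    |(ρ - 1 / 2).re| ≤ 1 / 2 := by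
  have h0 := ZetaZeros.riemannZetaNontrivialZeros.re_pos hρ
  have h1 := ZetaZeros.riemannZetaNontrivialZeros.re_lt_one hρ
  rw [abs_le]
  constructor <;> · simp; linarith

/-- `|Re (1/2 - ρ)| ≤ 1/2` on the non-trivial zeros. [folklore] -/
theorem abs_re_half_sub_le {ρ : ℂ} (hρ : ρ ∈ ZetaZeros.riemannZetaNontrivialZeros) :
    |(1 / 2 - ρ).re| ≤ 1 / 2 := by
  rw [show (1 / 2 - ρ) = -(ρ - 1 / 2) by ring, Complex.neg_re, abs_neg]
  exact abs_re_sub_half_le hρ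

/-- Absolute convergence of `Q(g)`: `∑_ρ ‖m(ρ) P_g(ρ)‖ < ∞`. [folklore] -/
theorem summable_norm_pairCoeff {g : ℝ → ℂ} (hg : IsWeilTest g) :
    Summable fun ρ : ZetaZeros.riemannZetaNontrivialZeros ↦
      ‖(riemannZetaZeroOrder (ρ : ℂ) : ℂ) * pairCoeff g ρ‖ :=
  summable_norm_zeroSide_of_le fun _ hρ ↦ norm_pairCoeff_le hg hρ

/-- Convergence of `Q(g)`. [folklore] -/
theorem summable_pairCoeff {g : ℝ → ℂ} (hg : IsWeilTest g) :
    Summable fun ρ : ZetaZeros.riemannZetaNontrivialZeros ↦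
      (riemannZetaZeroOrder (ρ : ℂ) : ℂ) * pairCoeff g ρ :=
  (summable_norm_pairCoeff hg).of_norm

/-- Absolute convergence of the exponential series: for `|Re w(ρ)| ≤ 1/2` the terms
`m(ρ) P_g(ρ) e^{w(ρ) x}` are summable. [folklore] -/
theorem summable_pairCoeff_mul_cexp {g : ℝ → ℂ} (hg : IsWeilTest g) (x : ℝ) {w : ℂ → ℂ}
    (hw : ∀ ρ ∈ ZetaZeros.riemannZetaNontrivialZeros, |(w ρ).re| ≤ 1 / 2) :
    Summable fun ρ : ZetaZeros.riemannZetaNontrivialZeros ↦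
      (riemannZetaZeroOrder (ρ : ℂ) : ℂ) * pairCoeff g ρ * cexp (w ρ * x) := by
  have h := summable_zeroSide_of_le (a := fun ρ ↦ pairCoeff g ρ * cexp (w ρ * x))
    (K := weilDecayConst g ^ 2 * Real.exp (|x| / 2)) fun ρ hρ ↦ by
      rw [norm_mul]
      calc ‖pairCoeff g ρ‖ * ‖cexp (w ρ * x)‖
          ≤ weilDecayConst g ^ 2 / (1 + ρ.im ^ 2) ^ 2 * Real.exp (|x| / 2) :=
            mul_le_mul (norm_pairCoeff_le hg hρ) (norm_cexp_mul_real_le (hw ρ hρ) x)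
              (norm_nonneg _) (div_nonneg (sq_nonneg _) (by positivity))
        _ = weilDecayConst g ^ 2 * Real.exp (|x| / 2) / (1 + ρ.im ^ 2) ^ 2 := by ring
  refine h.congr fun ρ ↦ ?_
  ring

/-- The series `B_g(x)` converges absolutely. [folklore] -/
theorem summable_expSum {g : ℝ → ℂ} (hg : IsWeilTest g) (x : ℝ) :
    Summable fun ρ : ZetaZeros.riemannZetaNontrivialZeros ↦
      (riemannZetaZeroOrder (ρ : ℂ) : ℂ) * pairCoeff g ρ * cexp (((ρ : ℂ) - 1 / 2) * x) :=
  summable_pairCoeff_mul_cexp hg x (w := fun ρ ↦ ρ - 1 / 2) fun _ hρ ↦ abs_re_sub_half_le hρ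

/-- The series `A_g(x)` converges absolutely. [folklore] -/
theorem summable_expSum' {g : ℝ → ℂ} (hg : IsWeilTest g) (x : ℝ) :
    Summable fun ρ : ZetaZeros.riemannZetaNontrivialZeros ↦
      (riemannZetaZeroOrder (ρ : ℂ) : ℂ) * pairCoeff g ρ * cexp ((1 / 2 - (ρ : ℂ)) * x) :=
  summable_pairCoeff_mul_cexp hg x (w := fun ρ ↦ 1 / 2 - ρ) fun _ hρ ↦ abs_re_half_sub_le hρ

/-- **`Q(g)` is the zero side of `g ⋆ g̃`**: `HasWeilZeroSide (g ⋆ g̃) (Q(g))`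
(`weilMellin_weilQuadratic` termwise, absolute convergence, `hasWeilZeroSide_tsum`).
[cite: Bombieri2000Weil, §3] -/
theorem hasWeilZeroSide_zeroForm {g : ℝ → ℂ} (hg : IsWeilTest g) :
    HasWeilZeroSide (weilConv g (weilReflect g)) (zeroForm g) := by
  have e : (fun ρ : ZetaZeros.riemannZetaNontrivialZeros ↦
      (riemannZetaZeroOrder (ρ : ℂ) : ℂ) * weilMellin (weilConv g (weilReflect g)) ρ) =
      fun ρ : ZetaZeros.riemannZetaNontrivialZeros ↦ (riemannZetaZeroOrder (ρ : ℂ) : ℂ) * pairCoeff g ρ := by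
    funext ρ
    rw [weilMellin_weilQuadratic hg, pairCoeff]
  have e' : (fun ρ : ZetaZeros.riemannZetaNontrivialZeros ↦
      ‖(riemannZetaZeroOrder (ρ : ℂ) : ℂ) * weilMellin (weilConv g (weilReflect g)) ρ‖) =
      fun ρ : ZetaZeros.riemannZetaNontrivialZeros ↦
        ‖(riemannZetaZeroOrder (ρ : ℂ) : ℂ) * pairCoeff g ρ‖ := by
    funext ρ
    rw [weilMellin_weilQuadratic hg, pairCoeff]
  have h := hasWeilZeroSide_tsum (g := weilConv g (weilReflect g))
    (by rw [e']; exact summable_norm_pairCoeff hg)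
  rwa [e] at h

/-- Under the hypothesis of `weil_criterion_zeroSide_converse`, `Re Q(g) ≥ 0` for every test
function `g`. [cite: Bombieri2000Weil, Thm. 1] -/
theorem zeroForm_re_nonneg
    (H : ∀ g : ℝ → ℂ, IsWeilTest g →
      ∀ Z : ℂ, HasWeilZeroSide (weilConv g (weilReflect g)) Z → 0 ≤ Z.re)
    {g : ℝ → ℂ} (hg : IsWeilTest g) : 0 ≤ (zeroForm g).re :=
  H g hg _ (hasWeilZeroSide_zeroForm hg)

/-! ### Translation and polarisation -/

/-- The test function `g + c·g_x`, `g_x(t) = g(t - x)`. [folklore] -/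
def translateMix (g : ℝ → ℂ) (c : ℂ) (x : ℝ) : ℝ → ℂ :=
  g + fun t ↦ c * weilTranslate g x t

/-- `g + c·g_x` is a test function. [folklore] -/
theorem isWeilTest_translateMix {g : ℝ → ℂ} (hg : IsWeilTest g) (c : ℂ) (x : ℝ) :
    IsWeilTest (translateMix g c x) :=
  hg.add ((hg.weilTranslate x).const_mul c)

/-- `(g + c g_x)^(s) = ĝ(s) (1 + c e^{(s - 1/2) x})`. [folklore] -/
theorem weilMellin_translateMix {g : ℝ → ℂ} (hg : IsWeilTest g) (c : ℂ) (x : ℝ) (s : ℂ) :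
    weilMellin (translateMix g c x) s = weilMellin g s * (1 + c * cexp ((s - 1 / 2) * x)) := by
  have hh : IsWeilTest fun t ↦ c * weilTranslate g x t := (hg.weilTranslate x).const_mul c
  rw [translateMix, weilMellin_add hg.1.continuous hg.2 hh.1.continuous hh.2,
    weilMellin_const_mul, weilMellin_weilTranslate]
  ring

/-- Termwise expansion:
`P_{g + c g_x}(ρ) = P_g(ρ) (1 + |c|² + conj c · e^{(1/2-ρ)x} + c · e^{(ρ-1/2)x})` (the cross
factor `e^{(ρ-1/2)x} · conj e^{(1/2-ρ̄)x} = 1` collapses because `x` is real). [folklore] -/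
theorem pairCoeff_translateMix {g : ℝ → ℂ} (hg : IsWeilTest g) (c : ℂ) (x : ℝ) (ρ : ℂ) :
    pairCoeff (translateMix g c x) ρ =
      pairCoeff g ρ * (1 + Complex.normSq c + conj c * cexp ((1 / 2 - ρ) * x) +
        c * cexp ((ρ - 1 / 2) * x)) := by
  have hY : conj (cexp ((1 - conj ρ - 1 / 2) * x)) = cexp ((1 / 2 - ρ) * x) := by
    rw [← Complex.exp_conj]
    congr 1
    simp only [map_mul, map_sub, map_one, map_div₀, map_ofNat, Complex.conj_conj,
      Complex.conj_ofReal]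
    ring
  have hXY : cexp ((ρ - 1 / 2) * x) * cexp ((1 / 2 - ρ) * x) = 1 := by
    rw [← Complex.exp_add, ← Complex.exp_zero]
    congr 1
    ring
  rw [pairCoeff, pairCoeff, weilMellin_translateMix hg, weilMellin_translateMix hg, map_mul,
    map_add, map_one, map_mul, hY, ← Complex.mul_conj]
  linear_combination weilMellin g ρ * conj (weilMellin g (1 - conj ρ)) * c * conj c * hXY

/-- **Polarised, translated positivity, summed**:
`Q(g + c g_x) = Q(g) + |c|² Q(g) + conj c · A_g(x) + c · B_g(x)`. [folklore] -/
theorem zeroForm_translateMix {g : ℝ → ℂ} (hg : IsWeilTest g) (c : ℂ) (x : ℝ) :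
    zeroForm (translateMix g c x) =
      zeroForm g + (Complex.normSq c * zeroForm g + (conj c * expSum' g x + c * expSum g x)) := by
  have hP := (summable_pairCoeff hg).hasSum
  have hA := (summable_expSum' hg x).hasSum
  have hB := (summable_expSum hg x).hasSum
  have h := hP.add ((hP.mul_left (Complex.normSq c : ℂ)).add ((hA.mul_left (conj c)).add
    (hB.mul_left c)))
  rw [zeroForm]
  refine Eq.trans (tsum_congr fun ρ ↦ ?_) h.tsum_eq
  rw [pairCoeff_translateMix hg]
  ring

/-! ### The reflection `ρ ↦ 1 - ρ̄` and the identity `conj A_g = B_g` -/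

/-- The reflection `ρ ↦ 1 - ρ̄` as a self-map of the non-trivial zeros. [folklore] -/
def reflect (ρ : ZetaZeros.riemannZetaNontrivialZeros) : ZetaZeros.riemannZetaNontrivialZeros :=
  ⟨1 - conj (ρ : ℂ), ZetaZeros.riemannZetaNontrivialZeros.one_sub_conj_mem ρ.2⟩

/-- The reflection on the underlying complex numbers. [folklore] -/
@[simp] theorem coe_reflect (ρ : ZetaZeros.riemannZetaNontrivialZeros) :
    ((reflect ρ : ZetaZeros.riemannZetaNontrivialZeros) : ℂ) = 1 - conj (ρ : ℂ) :=
  rfl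

/-- The reflection is an involution (`1 - conj (1 - conj ρ) = ρ`). [folklore] -/
theorem reflect_involutive : Function.Involutive reflect := fun ρ ↦
  Subtype.ext (by simp)

/-- The reflection as a permutation of the non-trivial zeros. [folklore] -/
def reflectEquiv : ZetaZeros.riemannZetaNontrivialZeros ≃ ZetaZeros.riemannZetaNontrivialZeros :=
  reflect_involutive.toPerm _

/-- `conj A_g(x) = B_g(x)`: conjugating `A_g` and re-indexing by the reflection (which fixes
ordinates and multiplicities, `riemannZetaZeroOrder_one_sub_conj`, and swaps `ĝ(ρ)` with
`ĝ(1 - ρ̄)`) gives `B_g`. [folklore] -/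
theorem conj_expSum' (g : ℝ → ℂ) (x : ℝ) : conj (expSum' g x) = expSum g x := by
  rw [expSum', Complex.conj_tsum, expSum, ← Equiv.tsum_eq reflectEquiv]
  refine tsum_congr fun σ ↦ ?_
  have h0 := ZetaZeros.riemannZetaNontrivialZeros.re_pos σ.2
  have h1 := ZetaZeros.riemannZetaNontrivialZeros.re_lt_one σ.2
  have hm : riemannZetaZeroOrder (1 - conj (σ : ℂ)) = riemannZetaZeroOrder (σ : ℂ) :=
    riemannZetaZeroOrder_one_sub_conj h0 h1
  have hE : conj (cexp ((1 / 2 - (1 - conj (σ : ℂ))) * x)) = cexp (((σ : ℂ) - 1 / 2) * x) := by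
    rw [← Complex.exp_conj]
    congr 1
    simp only [map_mul, map_sub, map_one, map_div₀, map_ofNat, Complex.conj_conj,
      Complex.conj_ofReal]
    ring
  show conj ((riemannZetaZeroOrder ((reflect σ : ZetaZeros.riemannZetaNontrivialZeros) : ℂ) : ℂ) *
      pairCoeff g ((reflect σ : ZetaZeros.riemannZetaNontrivialZeros) : ℂ) *
        cexp ((1 / 2 - ((reflect σ : ZetaZeros.riemannZetaNontrivialZeros) : ℂ)) * x)) = _
  rw [coe_reflect, map_mul, map_mul, hE, hm, map_intCast]
  simp only [pairCoeff, map_mul, map_sub, map_one, Complex.conj_conj, sub_sub_cancel]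
  ring

/-! ### Boundedness of `B_g` on the real line -/

/-- **`|B_g(x)| ≤ Re Q(g)` for all real `x`** under the hypothesis of the converse: expand
`Re Q(g + c g_x) ≥ 0` with `c = -conj B_g(x)/|B_g(x)|`. [folklore] -/
theorem norm_expSum_le
    (H : ∀ g : ℝ → ℂ, IsWeilTest g →
      ∀ Z : ℂ, HasWeilZeroSide (weilConv g (weilReflect g)) Z → 0 ≤ Z.re)
    {g : ℝ → ℂ} (hg : IsWeilTest g) (x : ℝ) : ‖expSum g x‖ ≤ (zeroForm g).re := by
  have hQ := zeroForm_re_nonneg H hg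
  set B := expSum g x with hBdef
  by_cases hB : B = 0
  · rw [hB, norm_zero]; exact hQ
  have hA : expSum' g x = conj B := by
    rw [hBdef, ← conj_expSum' g x, Complex.conj_conj]
  have hn0 : ‖B‖ ≠ 0 := norm_ne_zero_iff.2 hB
  have hn : (‖B‖ : ℂ) ≠ 0 := by exact_mod_cast hn0
  set c : ℂ := -conj B / (‖B‖ : ℂ) with hc
  have hcB : c * B = -(‖B‖ : ℂ) := by
    rw [hc, div_mul_eq_mul_div, neg_mul, Complex.conj_mul', neg_div]
    congr 1
    rw [sq, mul_div_assoc, div_self hn, mul_one]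
  have hc1 : Complex.normSq c = 1 := by
    rw [Complex.normSq_eq_norm_sq, hc, norm_div, norm_neg, Complex.norm_conj, Complex.norm_real,
      Real.norm_eq_abs, abs_norm, div_self hn0, one_pow]
  have h0 := zeroForm_re_nonneg H (isWeilTest_translateMix hg c x)
  rw [zeroForm_translateMix hg c x, hA, ← map_mul, hcB, hc1] at h0
  simp only [map_neg, Complex.conj_ofReal, Complex.ofReal_one, one_mul, add_re, neg_re,
    Complex.ofReal_re] at h0
  linarith

/-! ### No zeros off the line -/

/-- **`m(ρ) P_g(ρ) = 0` for every `ρ ∈ riemannZetaNontrivialZeros` with `Re ρ ≠ 1/2`**: apply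
`BoundedPowerSum.sum_fiber_eq_zero_of_exp_real` to the bounded series `B_g` (exponents
`ρ - 1/2`, pairwise distinct and locally finite; the fibre over `ρ₀ - 1/2` is `{ρ₀}`). [folklore] -/
theorem order_mul_pairCoeff_eq_zero
    (H : ∀ g : ℝ → ℂ, IsWeilTest g →
      ∀ Z : ℂ, HasWeilZeroSide (weilConv g (weilReflect g)) Z → 0 ≤ Z.re)
    {g : ℝ → ℂ} (hg : IsWeilTest g) {ρ₀ : ℂ} (hρ₀ : ρ₀ ∈ ZetaZeros.riemannZetaNontrivialZeros)
    (hre : ρ₀.re ≠ 1 / 2) :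
    (riemannZetaZeroOrder ρ₀ : ℂ) * pairCoeff g ρ₀ = 0 := by
  have h := Literature.Analysis.Complex.BoundedPowerSum.sum_fiber_eq_zero_of_exp_real (ι := ZetaZeros.riemannZetaNontrivialZeros)
    (c := fun ρ ↦ (riemannZetaZeroOrder (ρ : ℂ) : ℂ) * pairCoeff g ρ)
    (lam := fun ρ ↦ (ρ : ℂ) - 1 / 2) (R := 1 / 2) (M := (zeroForm g).re)
    (summable_norm_pairCoeff hg) (fun ρ ↦ abs_re_sub_half_le ρ.2) (fun z ↦ ?_)
    (fun x ↦ norm_expSum_le H hg x) (μ := ρ₀ - 1 / 2) (by simpa [sub_re] using sub_ne_zero.2 hre)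
    {⟨ρ₀, hρ₀⟩} (fun ρ ↦ ?_)
  · simpa using h
  · refine ⟨1, one_pos, ?_⟩
    refine ((riemannZetaNontrivialZeros_finite_inter_ball (z + 1 / 2) 1).preimage
      (Subtype.val_injective.injOn)).subset fun ρ hρ ↦ ?_
    simp only [mem_setOf_eq, Metric.mem_ball, dist_eq_norm] at hρ
    refine ⟨ρ.2, ?_⟩
    rw [Metric.mem_ball, dist_eq_norm]
    rwa [show (ρ : ℂ) - (z + 1 / 2) = (ρ : ℂ) - 1 / 2 - z by ring]
  · rw [Finset.mem_singleton, sub_left_inj]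
    constructor
    · rintro rfl; rfl
    · intro h; exact Subtype.ext h

/-- **Every zero of `ζ` off the real axis lies on the critical line** under the hypothesis of
the converse: choose a bump `g` with `Re ĝ > 0` on the horizontal line through `ρ` (which also
passes through `1 - ρ̄`), so `P_g(ρ) ≠ 0`, while `m(ρ) ≥ 1`. [cite: Bombieri2000Weil, Thm. 1] -/
theorem re_eq_one_half
    (H : ∀ g : ℝ → ℂ, IsWeilTest g →
      ∀ Z : ℂ, HasWeilZeroSide (weilConv g (weilReflect g)) Z → 0 ≤ Z.re)
    {ρ : ℂ} (hρ : ρ ∈ ZetaZeros.riemannZetaNontrivialZeros) : ρ.re = 1 / 2 := by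
  by_contra hre
  obtain ⟨g, hg, hpos⟩ := exists_isWeilTest_re_weilMellin_pos ρ.im
  have h := order_mul_pairCoeff_eq_zero H hg hρ hre
  have hm : (riemannZetaZeroOrder ρ : ℂ) ≠ 0 := by
    have := ZetaZeros.riemannZetaNontrivialZeros.one_le_order hρ
    exact_mod_cast (by omega : riemannZetaZeroOrder ρ ≠ 0)
  have h1 : weilMellin g ρ ≠ 0 := by
    intro h0
    have := hpos ρ.re
    rw [show (ρ.re : ℂ) + ρ.im * I = ρ from Complex.re_add_im ρ, h0, Complex.zero_re] at this
    exact lt_irrefl _ this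
  have h2 : weilMellin g (1 - conj ρ) ≠ 0 := by
    intro h0
    have := hpos (1 - ρ.re)
    rw [show ((1 - ρ.re : ℝ) : ℂ) + ρ.im * I = 1 - conj ρ from ?_, h0, Complex.zero_re] at this
    · exact lt_irrefl _ this
    · apply Complex.ext <;> simp
  exact (mul_ne_zero hm (mul_ne_zero h1 ((map_ne_zero _).2 h2))) h

/-- **Bombieri 2000, Theorem 1, "if" half (zero-side, semidefinite form) — MAIN THEOREM.** If for
every smooth compactly supported `g : ℝ → ℂ` every limit `Z` of the symmetric zero sums of
`g ⋆ g̃` (`HasWeilZeroSide (weilConv g (weilReflect g)) Z`) has `Re Z ≥ 0`, then the Riemann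
hypothesis holds. Non-trivial zeros (the zeros in the open strip,
`mem_riemannZetaNontrivialZeros_iff_holds`; they are off the real axis, `ZetaRealAxis.lean`) lie on
the critical line by `re_eq_one_half`; the strip form is Mathlib's `RiemannHypothesis` by
`riemannHypothesis_iff_strip_holds`. This is exactly
the body of the named fact `Literature.NumberTheory.LFunctions.weil_criterion_zeroSide_converse` (`WeilCriterionProofs.lean`,
which derives `weil_criterion_zeroSide_converse_holds` from it).
[cite: Bombieri2000Weil, Thm. 1 ("if" half; proof pp. 189–190)] -/
theorem riemannHypothesis_of_zeroSide_nonneg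
    (H : ∀ g : ℝ → ℂ, IsWeilTest g →
      ∀ Z : ℂ, HasWeilZeroSide (weilConv g (weilReflect g)) Z → 0 ≤ Z.re) :
    RiemannHypothesis :=
  riemannHypothesis_iff_strip_holds.2 fun _ hs h0 h1 ↦
    re_eq_one_half H (ZetaZeros.riemannZetaNontrivialZeros.mem_iff'.2 ⟨hs, h0, h1⟩)

end WeilConverse

end Literature.NumberTheory.LFunctions

end
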